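import Mathlib.FieldTheory.IntermediateField.Adjoin.Algebra
import Literature.AnabelianGeometry.AbsoluteAnabelian.AbsTopIII.KummerProp16iOfKummerLaws
import Literature.AnabelianGeometry.AbsoluteAnabelian.AbsTopIII.CurveModelSchemaWitnesses
import Literature.AnabelianGeometry.AbsoluteAnabelian.AbsTopIII.KummerFaithfulPadicConsequences
import HarnessLib

/-!
# [AbsTopIII] Prop. 1.6 (i): the interface laws (FG), (KUM) are jointly inhabited (non-vacuity, proof-only)

Companion of `KummerProp16iOfKummerLaws.lean` (abc-iut-w6-d075): there, Prop. 1.6 (i) of Mochizuki,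
*Topics in Absolute Anabelian Geometry III* (Prop. 1.6 (i) p. 34–35, manuscript pages, lit key
`paper:url-5493eb38cbb7`) is proved AT EVERY MODEL `M : KummerCurveModel` satisfying the interface laws
(FG) "`K_U` is finitely generated over `k`" and (KUM) "Kummer exactness: `κ_U(f) = 1 ⇒ f ∈ (K_U^×)^N`
for all `N`" (asked only at cyclotome presentations over a Kummer-faithful base).

CARRIER CENSUS (honest): the tree has NO non-degenerate `KummerCurveModel` with a genuine Kummer map
(no étale `π₁`; `CurveModelSchemaWitness.toyKummerModel` and
`CuspidalCyclotomeKummerUnitsClosureRefutations.model` are refutation toys with `κ := 1` on nontrivial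
units).  This file records the KERNEL NON-VACUITY that the two laws are JOINTLY inhabited AT A MODEL
WHERE THE GUARDS OF (KUM) ARE MET: the toy cyclotome presentation `G_ℚ × Ẑ ↠ G_ℚ` over the
Kummer-faithful field `ℚ` (`isKummerFaithful_rat`), scheme-like, with `I ≅ Ẑ`
(`CurveModelSchemaWitness.isCyclotomePresentation_toyModel_zHat`), carrying the DEGENERATE Kummer
datum `Γ(U, 𝒪_U^×) := 1`, `κ_U := 1` — so (KUM) holds non-vacuously in its guards and trivially in its
conclusion, (FG) holds (`K_U = ℚ`), and Prop. 1.6 (i) holds there by the closer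
`KummerCurveModel.prop_1_6_i_of_kummerExact`.  Evidence of joint satisfiability only; a genuine carrier
is an E-list item.  No definition (the witness model is built inline); nothing here bears on [IUTchIII]
Cor. 3.12.
-/

noncomputable section

open scoped Classical

namespace Literature.AnabelianGeometry.AbsoluteAnabelian.AbsTopIII

/-- **(FG) and (KUM) are jointly inhabited, with the guards of (KUM) met, and Prop. 1.6 (i) holds
there**: witness = the toy cyclotome presentation over `ℚ` with trivial regular units and `κ := 1`.
[cite: MochizukiAbsTopIII2015, Prop 1.6 (i) p.34] -/
theorem exists_kummerCurveModel_fg_and_kummerExact :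
    ∃ M : KummerCurveModel.{0},
      (∀ U : M.Curve, (⊤ : IntermediateField (M.base U) (M.FunctionField U)).FG) ∧
      (∀ (U Ux X : M.Curve) (h₁ : M.IsCofiniteOpen U Ux) (h₂ : M.IsCofiniteOpen Ux X)
        (x : (M.cusps Ux).Cusp), M.IsScheme U → M.IsCyclotomePresentation h₂ x →
        IsKummerFaithful (M.base U) →
        ∀ f : M.regularUnits U, M.kummer h₁ h₂ f = 1 →
          ∀ N : ℕ, 0 < N → ∃ g : (M.FunctionField U)ˣ, g ^ N = (f : (M.FunctionField U)ˣ)) ∧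
      (∃ (U Ux X : M.Curve) (_ : M.IsCofiniteOpen U Ux) (h₂ : M.IsCofiniteOpen Ux X)
        (x : (M.cusps Ux).Cusp),
        M.IsScheme U ∧ M.IsCyclotomePresentation h₂ x ∧ IsKummerFaithful (M.base U)) ∧
      Literature.AnabelianGeometry.AbsoluteAnabelian.AbsTopIII.Prop_1_6_i M := by
  let M : KummerCurveModel.{0} :=
    { toCurveModel := CurveModelSchemaWitness.toyModel ℚ CurveModelSchemaWitness.ZHat
      regularUnits := fun _ => ⊥
      kummer := fun _ _ => 1 }
  have hFG : ∀ U : M.Curve, (⊤ : IntermediateField (M.base U) (M.FunctionField U)).FG :=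
    fun _ => IntermediateField.fg_top _ _
  have hKum : ∀ (U Ux X : M.Curve) (h₁ : M.IsCofiniteOpen U Ux) (h₂ : M.IsCofiniteOpen Ux X)
      (x : (M.cusps Ux).Cusp), M.IsScheme U → M.IsCyclotomePresentation h₂ x →
      IsKummerFaithful (M.base U) →
      ∀ f : M.regularUnits U, M.kummer h₁ h₂ f = 1 →
        ∀ N : ℕ, 0 < N → ∃ g : (M.FunctionField U)ˣ, g ^ N = (f : (M.FunctionField U)ˣ) := by
    intro U Ux X h₁ h₂ x _ _ _ f _ N _
    refine ⟨1, ?_⟩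
    rw [one_pow]
    exact (Subgroup.mem_bot.mp f.2).symm
  refine ⟨M, hFG, hKum, ?_, KummerCurveModel.prop_1_6_i_of_kummerExact M hFG hKum⟩
  exact ⟨PUnit.unit, PUnit.unit, PUnit.unit, trivial, trivial, PUnit.unit, trivial,
    CurveModelSchemaWitness.isCyclotomePresentation_toyModel_zHat ℚ PUnit.unit, isKummerFaithful_rat⟩

end Literature.AnabelianGeometry.AbsoluteAnabelian.AbsTopIII
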